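import Summits.QuantumFields.YangMills.Theorems.BalabanUVNodesN08Thm2AtRecordSeamK0
import Literature.MathematicalPhysics.QuantumFieldTheory.Balaban1983to89.B10Eq2HaarCompatibility

/-!
# BalabanUVNodes ∕ N08 — [Balaban1985UV3] Thm 2 at the runs of record: THE BRIDGE'S DATA SIDE IS INHABITED AT PRINT'S OWN AVERAGING, and the two
# k = 0 analytic leaves of the d = 3 lane's towers pinned to the record's binders are discharged (`εbg > 2`)

Track A, DAG node N08 = T. Bałaban, CMP **102** (1985) 255–275 [Balaban1985UV3]: (1)–(7) pp. 256–257, (38)–(43) p. 266, Thm 2 p. 272; [7] =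
[Balaban1985Variational] Thm 1 p. 279; print's averaging (2) = [Balaban1985Averaging] (15) p. 19.  Cell `pub-ymgap`, width seat `pub-ymgap-dag-n08-w1`,
W-SEAT-START-LIST §n08 item 1 (file 3); `--supports` K1⁷ `StabilityBAtRecordR13SepCoPH` (helper).  Companion of `BalabanUVNodesN08Thm2AtRecordSeamK0` §4 (the
BRIDGE: lane tower inputs PINNED TO THE RECORD'S BINDERS extend them for `εbg > 2`, so leaf systems on the lane's towers ARE the record's per-run data).

WHAT THIS FILE PROVES (kernel; theorems only; nothing of the paper asserted).
* §1 For ANY family of lane tower inputs `D` pinned to the record's binders with `εbg > 2` and print's k = 0 interaction data `Pint 0 ≡ 0` ((43) at k = 0), the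
  two k = 0 fields of the lane's `UVStability3D.AnalyticLeaves` HOLD on the pinned tower `tower3 (D S)`: `noInt0_tower3` and ★ `step0_tower3`
  (`B10.Step0Printed`, by the lane's `Step0Tower.step0_pin` — its `hU0 : U₀ = id` being the record's `U₀` for `εbg > 2`, `SeamK0` §3 — and the lane's
  `Carriers.lf_zero`); so at the record's binders the located object gap of the socket is the `k ≥ 1` content only (the fourteen step leaves, (46), (65)'s
  inputs, the large-field control).
* §2 **NON-VACUITY (cell rule A6) of the bridge's data side AT THE SLOT OF RECORD ITSELF**: there EXIST admissible constants `c` (`εbg = 3 > 2`), a version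
  family `𝔗 : Node00.TFamily₃ N L` of (2) along PRINT'S OWN averaging `avOfPrint` and lane tower inputs `D S` with `(D S).av = avOfPrint N S`, pinned to the
  record's binders, such that **the lane's stage-1 towers extend the slot of record's own binders on the nose**:
  `((D S).towerWith _).toRunObjects = runObjects₀T N 𝔗 (Backgrounds.ofPrint N L) c S` for every `S`, with `Step0Printed ∧ NoInteraction0` on every `tower3 (D S)`
  (`exists_towerWith_extends_slotOfRecord`).  The lane's binder `AvgAC` is met by print's averaging at EVERY level from the tree
  (`B10Eq2HaarCompatibility.measurable_avOfPrint` + `haarAC_of_rtOpI (TOfPrint N S j)`): `avgAC_avOfPrint`.  The witness inputs carry TRIVIAL expansion data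
  (masses 1, `Pint ≡ 0`, zero profiles) — they inhabit the binder-pinning hypotheses, NOT the analytic leaves for `k ≥ 1`.
* §3 THE DEFINITIONAL ALTERNATIVE in kernel form: over ANY background assignment `𝔅` with the identity at level 0 the lane's towers extend the binders
  `runObjects₀A N 𝔞_D 𝔗_D 𝔅 c S` with NO condition on `εbg` (`towerWith_toRunObjects_eq_of_uk_zero_id`) — what re-pointing level 0 of the record's
  `Backgrounds` to `id` (the owners' call, not made here) would buy.

HONEST FRAMING: count-neutral helper; N08 NOT discharged; `PrintedUV3V` NOT proved (the `k ≥ 1` analytic leaves over towers at the record's binders = N08's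
object gap); one finite 𝕋⁴ programme at fixed ε, Bałaban AS PRINTED; nothing continuum ∕ ℝ⁴ ∕ OS ∕ mass gap ∕ Clay.  No `sorry`, standard axioms.
-/

noncomputable section

namespace Summit.QuantumFields.YangMills.BalabanUVNodes.N08Thm2AtRecordBridgeInhabited

open Literature.MathematicalPhysics.QuantumFieldTheory.Balaban1983to89
open Literature.MathematicalPhysics.QuantumFieldTheory.Balaban1983to89.Node00 (SU TFamily₃)
open Literature.MathematicalPhysics.QuantumFieldTheory.Balaban1983to89.B10RunsOfRecord
open Literature.MathematicalPhysics.QuantumFieldTheory.Balaban1985CMP102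
open Literature.MathematicalPhysics.QuantumFieldTheory.Balaban1985CMP102.Setting
open Summit.QuantumFields.Balaban3D
open Summit.QuantumFields.YangMills.BalabanUVNodes.N08Thm2AtRecordLevelZero
open Summit.QuantumFields.YangMills.BalabanUVNodes.N08Thm2AtRecordSeamK0

variable {N : ℕ} [NeZero N] {L : ℕ}

/-! ## §1 The k = 0 analytic leaves of lane towers pinned to the record's binders (`εbg > 2`) -/
section LevelZeroLeaves

variable (D : ∀ S : Scales L, Carriers.TowerInput S (SU N)) (c : Consts L)

/-- **`AnalyticLeaves.noInt0` on the pinned lane tower** from print's k = 0 interaction data `Pint 0 ≡ 0` ((43): the sum starts at `j = 1`).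
[cite: Balaban1985UV3, (43) p.266 (at k = 0)] -/
theorem noInt0_tower3 {S : Scales L} (hP0 : ∀ (h : Carriers.Hist S.P 0) (V : GaugeField S.P 0 (SU N)), (D S).Pint 0 h V = 0) :
    B10LargeField.NoInteraction0 (D S).tower3.toTowerRun :=
  Proofs.Step0Tower.noInt0_towerObjects ((D S).towerWith fun _ => True).pin hP0

/-- ★ **`AnalyticLeaves.step0` ((41)₀ ∧ (47)₀, (1) p. 256) on the lane tower PINNED TO THE RECORD'S BINDERS, `εbg > 2`** — the lane's `Step0Tower.step0_pin`
with its `hU0` supplied by `SeamK0.uk_zero_eq_self_of_two_lt` (the record's `U₀` IS `id` for `εbg > 2`) and `LF 0 V F = exp (F triv)` by `Carriers.lf_zero`.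
[cite: Balaban1985UV3, (1) p.256 + (41) p.266 + (47) p.267] -/
theorem step0_tower3 (hε : 2 < c.εbg)
    (hε₁ : ∀ (S : Scales L) k, (D S).ε₁ k = eps1OfPrint c S k) (hreg : ∀ (S : Scales L) k, (D S).reg k = bgReg3 N S k c.εbg)
    (hUk : ∀ (S : Scales L) k (V : GaugeField S.P (k + 1) (SU N)), (D S).Uk k V = UkA N (fun S => (D S).av) S (k + 1) c.εbg V)
    (hE : ∀ S : Scales L, B10.Ek (D S).Estep S.K 0 = c.E S) {S : Scales L}
    (hP0 : ∀ (h : Carriers.Hist S.P 0) (V : GaugeField S.P 0 (SU N)), (D S).Pint 0 h V = 0) :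
    B10.Step0Printed (D S).tower3.toTowerRun :=
  step0_of_two_lt (towerWith_toRunObjects_eq D c hε hε₁ hreg hUk hE S) hε (fun V F => Carriers.lf_zero (D S).W V F) hP0

end LevelZeroLeaves

/-! ## §2 Non-vacuity at the slot of record: lane tower inputs at PRINT'S OWN averaging, pinned to the record's binders, exist -/
section Inhabited

variable (N L)

/-- **The lane's binder `AvgAC` («Ū measurable and `Ū_*(dU) ≪ dV`») holds for PRINT'S OWN averaging (2) = [Balaban1985Averaging] (15) on SU(N) at EVERY level**
(tree: `B10Eq2HaarCompatibility.measurable_avOfPrint`, `haarAC_of_rtOpI` at print's Radon–Nikodym version `TOfPrint`). [cite: Balaban1985Averaging, (10) + (15) p.19] -/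
theorem avgAC_avOfPrint (S : Scales L) (j : ℕ) : Carriers.AvgAC (avOfPrint N S j).avg :=
  ⟨B10Eq2HaarCompatibility.measurable_avOfPrint N S j,
    B10Eq2HaarCompatibility.haarAC_of_rtOpI (TOfPrint N S j) (B10Eq2HaarCompatibility.measurable_avOfPrint N S j)⟩

/-- Admissible constants with class radius `εbg = 3 > 2` and vacuum energies `E ≡ 0` (`ε₀`, `b₀`, `p₀` the documented junk of `Consts.junk`).
[cite: Balaban1985UV3, p.256 L15–18 + (7) p.257 (bookkeeping)] -/
theorem junk3_adm : ({ Consts.junk L with εbg := 3 } : Consts L).Adm := by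
  obtain ⟨h1, h2, h3, -⟩ := Consts.junk_adm L
  exact ⟨h1, h2, h3, by show (0 : ℝ) < 3; norm_num⟩

/-- ★★ **NON-VACUITY OF THE BRIDGE'S DATA SIDE AT THE SLOT OF RECORD** (cell rule A6): admissible constants `c` with `εbg > 2`, a version family `𝔗` of (2)
ALONG PRINT'S OWN AVERAGING (`Node00.TFamily₃ N L`) and lane tower inputs `D` with `(D S).av = avOfPrint N S`, pinned to the record's binders, such that the
lane's stage-1 towers EXTEND THE SLOT OF RECORD'S OWN BINDERS `runObjects₀T N 𝔗 (Backgrounds.ofPrint N L) c S` on the nose at every lattice approximation, and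
the two k = 0 analytic leaves hold on every pinned tower.  The witness carries TRIVIAL expansion data (masses `1`, `Pint ≡ 0`, zero profiles, `U_k(V,h) := U_k(V)`):
it inhabits the binder-pinning hypotheses of `SeamK0` §4, not the `k ≥ 1` analytic leaves. [cite: Balaban1985UV3, (1)–(7) pp.256–257 + (38)–(43) p.266 (bookkeeping)] -/
theorem exists_towerWith_extends_slotOfRecord :
    ∃ (c : Consts L) (𝔗 : TFamily₃ N L) (D : ∀ S : Scales L, Carriers.TowerInput S (SU N)),
      c.Adm ∧ 2 < c.εbg ∧ (∀ S, (D S).av = avOfPrint N S) ∧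
        (∀ S, ((D S).towerWith fun _ => True).toRunObjects = runObjects₀T N 𝔗 (Backgrounds.ofPrint N L) c S) ∧
          ∀ S, B10.Step0Printed (D S).tower3.toTowerRun ∧ B10LargeField.NoInteraction0 (D S).tower3.toTowerRun := by
  let c : Consts L := { Consts.junk L with εbg := 3 }
  let D : ∀ S : Scales L, Carriers.TowerInput S (SU N) := fun S =>
    { ε₁ := eps1OfPrint c S
      av := avOfPrint N S
      avgAC := avgAC_avOfPrint N L S
      reg := fun k => bgReg3 N S k c.εbg
      Uk := fun k V => UkA N (avOfPrint N) S (k + 1) c.εbg V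
      lower := fun _ _ => 0
      upper := fun _ _ => 0
      lower_nonneg := fun _ _ => le_rfl
      upper_nonneg := fun _ _ => le_rfl
      M₁ := 1
      Rcol := fun _ => 1
      b₀ := c.b₀
      p₀ := c.p₀
      κ₀ := 1
      W := ⟨fun _ _ _ => 1, fun _ _ _ => zero_le_one, fun _ _ _ => le_rfl, fun _ _ => rfl⟩
      UkH := fun k _ V => Carriers.ukAll (fun k V => UkA N (avOfPrint N) S (k + 1) c.εbg V) k V
      UkH_triv := fun _ _ => rfl
      Pint := fun _ _ _ => 0
      zcoef := fun _ => 0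
      rcoef := fun _ => 0
      Estep := fun _ => 0 }
  have hε : 2 < c.εbg := by show (2 : ℝ) < 3; norm_num
  have hE : ∀ S : Scales L, B10.Ek (D S).Estep S.K 0 = c.E S := fun S => by
    show ∑ j ∈ Finset.Ico 0 S.K, (0 : ℝ) = 0
    exact Finset.sum_const_zero
  have hext : ∀ S, ((D S).towerWith fun _ => True).toRunObjects =
      runObjects₀A N (fun S => (D S).av) (fun S j => (Carriers.run3 ((D S).toRunInput fun _ => True)).T j)
        (Backgrounds.ofAvg N L fun S => (D S).av) c S :=
    towerWith_toRunObjects_eq D c hε (fun _ _ => rfl) (fun _ _ => rfl) (fun _ _ _ => rfl) hE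
  refine ⟨c, fun S j => (Carriers.run3 ((D S).toRunInput fun _ => True)).T j, D, junk3_adm L, hε, fun _ => rfl, hext, fun S => ⟨?_, ?_⟩⟩
  · exact step0_tower3 D c hε (fun _ _ => rfl) (fun _ _ => rfl) (fun _ _ _ => rfl) hE (fun _ _ => rfl)
  · exact noInt0_tower3 D (fun _ _ => rfl)

end Inhabited


/-! ## §3 The definitional alternative: ANY background assignment with `U₀ = id` is extended by the lane's towers, every `εbg` -/
section DefinitionalAlternative

/-- **THE DEFINITIONAL ALTERNATIVE TO `εbg > 2`** (the owners' option recorded in `SeamK0`'s docstring, here in kernel form over a GENERIC background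
assignment): if a background assignment `𝔅 : Consts L → Backgrounds N L` has the IDENTITY at level 0 (`(𝔅 c).Uk S 0 V = V`), then lane tower inputs whose
`ε₁`, classes, `U_k` (`k ≥ 1`) and `Σ E^{(j)}` are `𝔅 c`'s ∕ print's extend the binders `runObjects₀A N 𝔞_D 𝔗_D 𝔅 c S` on the nose — NO condition on the
class radius.  (With the record's `Backgrounds.ofAvg`, whose level 0 is [7]'s minimiser-or-junk, this hypothesis is `SeamK0` §1's `εbg > 2` case.)
[cite: Balaban1985UV3, (5) p.256 L35–36 + (38)–(43) p.266 (bookkeeping)] -/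
theorem towerWith_toRunObjects_eq_of_uk_zero_id (D : ∀ S : Scales L, Carriers.TowerInput S (SU N)) (𝔅 : Consts L → Backgrounds N L) (c : Consts L)
    (h0 : ∀ (S : Scales L) (V : GaugeField S.P 0 (SU N)), (𝔅 c).Uk S 0 V = V)
    (hε₁ : ∀ (S : Scales L) k, (D S).ε₁ k = eps1OfPrint c S k) (hreg : ∀ (S : Scales L) k, (D S).reg k = (𝔅 c).reg S k)
    (hUk : ∀ (S : Scales L) k (V : GaugeField S.P (k + 1) (SU N)), (D S).Uk k V = (𝔅 c).Uk S (k + 1) V)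
    (hE : ∀ S : Scales L, B10.Ek (D S).Estep S.K 0 = c.E S) (S : Scales L) :
    ((D S).towerWith fun _ => True).toRunObjects =
      runObjects₀A N (fun S => (D S).av) (fun S j => (Carriers.run3 ((D S).toRunInput fun _ => True)).T j) 𝔅 c S := by
  have hU : ∀ (k : ℕ) (V : GaugeField S.P k (SU N)), (Carriers.run3 ((D S).toRunInput fun _ => True)).Uk k V = (𝔅 c).Uk S k V := by
    intro k V
    cases k with
    | zero => exact (h0 S V).symm
    | succ k => exact hUk S k V
  exact runObjects_ext _ _ (hE S) (funext (hε₁ S)) rfl HEq.rfl (funext (hreg S)) (funext fun k => funext (hU k)) rfl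

end DefinitionalAlternative

end Summit.QuantumFields.YangMills.BalabanUVNodes.N08Thm2AtRecordBridgeInhabited

end
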